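import Literature.MathematicalPhysics.QuantumFieldTheory.Balaban1983to89.B9Eq324DeltaPrimeAZd

/-!
# `Balaban1983to89.B9Eq325QGGQInvZd` — [Balaban1985BackgroundPropagators] (3.25) p. 394 «(Q′G′²Q′*)⁻¹» AT THE `ℤᵈ × 𝔸` CARRIERS, AS AN OBJECT: the
# multi-level averaging `Q′ = (𝟙_{Λ_j}Q′_j(U₀))_{j≤m} : L²(Ω₀, ·) → L²(𝔅, ·)`, its `τ`-adjoint `Q′*` (the Riesz transposes of `B9Eq324DeltaPrimeAZd`), the operator
# `Q′G′(U₀)²Q′*` on the level data `L²(𝔅, ·)` (`𝔅 = ⋃_{j≤m} {j} × Λ_j`) with `G′(U₀) = (Ω₀Δ′_aΩ₀)⁻¹` the OBJECT of `B9Eq324DeltaPrimeAZd`, the identity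
# `⟨φ, Q′G′²Q′*φ⟩_τ = ‖G′Q′*φ‖²_τ`, and THEOREM 3.11's clause for the THIRD «obvious» operator PROVED AT THE CARRIER: whenever `Q′*` is injective on the
# level data (print's «Q′ is onto», the block geometry — displayed), `Q′G′²Q′*` is positive definite on `L²(𝔅, ·)`, hence invertible, for EVERY unitary `U₀`,
# `a ≥ 0`, finite `Ω₀` — **`(Q′G′²Q′*)⁻¹` IS AN OBJECT** (`cZd`), positive definite and symmetric; with it all three operators of (3.25) exist at the carrier

statement-level skeleton of published theorems with citation tags; proofs where landed; nothing here is a claim about the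
Yang–Mills mass gap

`[Balaban1985BackgroundPropagators]` ("B9", CMP **99** (1985) 389–434) p. 394: *«Using the Lagrange multipliers method the minimum of (3.22) can be found by
the same calculations as in [4], (2.15)–(2.17), and we obtain the formula Rf = (I − G′Q′*(Q′G′²Q′*)⁻¹Q′G′)f, (3.25) where G′ = G′(U) = (Δ′_a)⁻¹. We do not
know yet if the operators in the above formulas are well defined, e.g. if Δ′_a, Q′G′²Q′* are invertible. It will be proved later (Theorem 3.11)»*; p. 416,
Theorem 3.11: *«the operators Δ′_a, G′, (Q′G′²Q′*)⁻¹, Δ_a, G are positive definite. This is obvious for the first three operators»*; p. 393 (3.18)–(3.19)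
(the multi-level averaging `Q′_j`, the sets `Λ_j`, `𝔅`); p. 391 *«The adjoints are taken with respect to natural L² scalar products»*.
PDF held: `paper:balaban1985-cmp99-background-propagators` pp. 393–394, 416 (re-read by this seat, 2026-08-28).

CITATION HEADER (lean-in-tree rule).  Cell `pub-ymgap` (YM Track A, HUMAN RULING D-0062 ∕ D-0149 width push), DAG node N06 = [B9], width seat
`pub-ymgap-dag-n06-w4` (g2), `W-SEAT-START-LIST` v8 § n06 ITEM 4 (γ) — this seat's gauge-fixing column at the `ℤᵈ` carrier: `R(U₀)` (g0
`B9Eq321LandauProjectionZd`), `G(U₀)` (`B9Eq327GreenZd`), `Δ′_a(U₀) ∕ G′(U₀)` (`B9Eq324DeltaPrimeAZd`), and here the third operator of (3.25).  All carriers,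
pairings and transposes are the previous files' BY NAME (`suppSub ∕ formE`, `fibreForm ∕ transposeOn ∕ sum_pair_transposeOn`, `QprimeLin`, `deltaPrimeADom`,
`GpZd`, `formE_GpZd_symm`).

WHAT IS DECLARED ∕ PROVED (kernel, 0 sorry; definitions with bodies + theorems; no `instance`, no `notation`).
* §1 THE LEVEL-DATA CARRIER `L²(𝔅, ·)`: `levSupp m Λ` (functions `ℕ × Site d → 𝔸` vanishing off `𝔅 = {(j, y) : j ≤ m, y ∈ Λ_j}`), `levForm τ m Λ` (the pairing
  `Σ_{j≤m} Σ_{y∈Λ_j} Re τ(φ(j,y)* ψ(j,y))`), `levForm_apply`, `levForm_self_nonneg`, `levForm_self_eq_zero` (faithful `τ`), `finiteDimensional_levSupp`.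
* §2 ★ `QprimeVec` (`Q′ : f ↦ (𝟙_{Λ_j}Q′_j(U₀)f)_{j≤m}`, `L²(Ω₀,·) → L²(𝔅,·)`), ★ `QprimeStar` (`Q′* : φ ↦ Ω₀Σ_{j≤m} Q′_j(U₀)ᵀ_{Λ_j}φ_j`), ★★ `formE_qprimeStar`
  (ADJOINTNESS `⟨Q′*φ, f⟩_{τ,Ω₀} = ⟨φ, Q′f⟩_{τ,𝔅}`, Hermitian `τ`).
* §3 ★ `qggq …` = **`Q′G′(U₀)²Q′*`** on `L²(𝔅, ·)`; ★★ `levForm_qggq_self` (`⟨φ, Q′G′²Q′*φ⟩_τ = ⟨G′Q′*φ, G′Q′*φ⟩_τ`), `levForm_qggq_self_nonneg`, `levForm_qggq_symm`;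
  `QprimeStarInjective` (the displayed hypothesis: `Q′*` injective on `L²(𝔅, ·)` = «`Q′` onto», print's block geometry), ★★ `levForm_qggq_self_eq_zero`
  (under it: `⟨φ, Q′G′²Q′*φ⟩ = 0 ⟹ φ = 0`).
* §4 THEOREM 3.11, THIRD «OBVIOUS» OPERATOR, AT THE CARRIER: ★★★ `qggq_bijective` (every unitary `U₀`, `a ≥ 0`, finite `Ω₀`, `0 < d`, `η ≠ 0`, `Q′*` injective),
  ★ `cZd …` = **`(Q′G′²Q′*)⁻¹`** (a linear equivalence of `L²(𝔅, ·)`), `cZd_qggq ∕ qggq_cZd`, ★★ `levForm_cZd_self_pos` (positive definite), `levForm_cZd_symm`.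
* §5 A SUFFICIENT CONDITION FOR THE DISPLAYED HYPOTHESIS: `SeparatingSites` (every constraint point `(j, y)` owns a site `x ∈ Ω₀` seen by `Q′_j` at `y` through
  a SURJECTIVE fibre map and by no other constraint point — print's disjoint blocks `B^j(y) ⊂ Ω_j ∖ Ω_{j+1}`), ★ `qprimeStarInjective_of_separating`;
  A6: `separatingSites_levelZero` ∕ `qprimeStarInjective_levelZero` (at `m = 0`, `Λ_0 ⊆ Ω₀`, the clause holds — the hypothesis class of §4 is inhabited).

HONEST SCOPE.  (i) The third operator of (3.25) made an object and its qualitative invertibility proved from `G′`'s (this seat's `B9Eq324DeltaPrimeAZd`) under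
the displayed injectivity of `Q′*` (§5 reduces it to a site-separation clause; deriving that clause from a member's laws `ZdIdx.hbox ∕ hclass ∕ htower` is
the law owners' ∕ a successor's — NOT done); print's UNIFORM statement (constants via Theorem 3.1) is NOT claimed.  (ii) The formula (3.25) for this seat's
`R(U₀)` (`projE`, whose range is the `𝔤`-VALUED `Δ^η_{U₀}N_𝔤(Q′)`) needs the three operators on the Hermitian sub-carrier — located, NOT done here.  (iii) `τ` a
PARAMETER (tracial, Hermitian, faithful), `𝔸` finite-dimensional — no instance.  (iv) Count-neutral; N05 ∕ N06 NOT discharged; K1⁷ `stmt-QuantumFields-20542`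
NOT closed; one finite `𝕋⁴` programme at fixed `ε`, Bałaban as printed; R4 closes only the conditional finite-`𝕋⁴` rung `BalabanLadder.UV` — nothing continuum ∕
ℝ⁴ ∕ OS ∕ mass gap ∕ Clay.  Unit `pub-ymgap-dag-n06-w4` (g2), 2026-08-28.
-/

noncomputable section

namespace Literature.MathematicalPhysics.QuantumFieldTheory.Balaban1983to89.B9Eq325QGGQInvZd

open B7Prop1Explicit B7Eq78Linearization
open B7Prop2Explicit (unitaryUnits)
open B8Eq119TwistedAxial (bgT)
open B9Eq321LandauProjectionZd (suppSub formE indicator_mem_suppSub formE_apply formE_isSymm formE_apply_self_eq_zero)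
open B9Eq324DeltaPrimeAZd (fibreForm fibreForm_apply fibreForm_comm single transposeOn sum_pair_transposeOn QprimeLin QprimeLin_apply restrictSite
  restrictSite_coe deltaPrimeADom GpZd deltaPrimeADom_GpZd GpZd_deltaPrimeADom formE_GpZd_symm finiteDimensional_suppSub')

-- `Site` alone could resolve to the torus sites of `Setup.lean`; re-export the `ℤ^d` sites of `B7Prop1Explicit`.
export B7Prop1Explicit (Site)

variable {d : ℕ} {𝔸 : Type*} [CStarAlgebra 𝔸]

/-! ## §1  The level-data carrier `L²(𝔅, ·)`, `𝔅 = {(j, y) : j ≤ m, y ∈ Λ_j}` -/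

section Carrier

variable (τ : 𝔸 →ₗ[ℂ] ℂ) (m : ℕ) (Λ : ℕ → Finset (Site d))

/-- **`L²(𝔅, ·)`**: level data `φ : ℕ × ℤᵈ → 𝔸` vanishing off `𝔅 = ⋃_{j ≤ m} {j} × Λ_j` («L²(𝔅)», the target of `Q′`, (3.18)–(3.19)).
[cite: Balaban1985BackgroundPropagators, (3.18)–(3.19) p.393, (3.24) p.394] -/
def levSupp : Submodule ℝ (ℕ × Site d → 𝔸) where
  carrier := {φ | ∀ p : ℕ × Site d, ¬ (p.1 ∈ Finset.range (m + 1) ∧ p.2 ∈ Λ p.1) → φ p = 0}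
  add_mem' := by
    intro φ ψ hφ hψ p hp
    rw [Pi.add_apply, hφ p hp, hψ p hp, add_zero]
  zero_mem' := fun _ _ => rfl
  smul_mem' := by
    intro c φ hφ p hp
    rw [Pi.smul_apply, hφ p hp, smul_zero]

/-- **THE PAIRING ON `L²(𝔅, ·)`**: `Σ_{j≤m} Σ_{y∈Λ_j} Re τ(φ(j,y)* ψ(j,y))` (print's `Σ_j Σ_{y∈Λ_j}(Lʲη)^d tr`, volume weights dropped as in the sibling files).
[cite: Balaban1985BackgroundPropagators, (3.24) p.394, p.391 («natural L² scalar products»)] -/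
def levForm : LinearMap.BilinForm ℝ (levSupp (𝔸 := 𝔸) m Λ) :=
  LinearMap.mk₂ ℝ (fun φ ψ => ∑ j ∈ Finset.range (m + 1), ∑ y ∈ Λ j, (τ (star ((φ : ℕ × Site d → 𝔸) (j, y)) * (ψ : ℕ × Site d → 𝔸) (j, y))).re)
    (fun φ₁ φ₂ ψ => by
      simp only [Submodule.coe_add, Pi.add_apply, star_add, add_mul, map_add, Complex.add_re, Finset.sum_add_distrib])
    (fun c φ ψ => by
      simp only [Submodule.coe_smul, Pi.smul_apply, star_smul, star_trivial, smul_mul_assoc, smul_eq_mul, Finset.mul_sum]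
      refine Finset.sum_congr rfl fun j _ => Finset.sum_congr rfl fun y _ => ?_
      rw [← Complex.coe_smul, map_smul, smul_eq_mul, Complex.re_ofReal_mul])
    (fun φ ψ₁ ψ₂ => by
      simp only [Submodule.coe_add, Pi.add_apply, mul_add, map_add, Complex.add_re, Finset.sum_add_distrib])
    (fun c φ ψ => by
      simp only [Submodule.coe_smul, Pi.smul_apply, mul_smul_comm, smul_eq_mul, Finset.mul_sum]
      refine Finset.sum_congr rfl fun j _ => Finset.sum_congr rfl fun y _ => ?_
      rw [← Complex.coe_smul, map_smul, smul_eq_mul, Complex.re_ofReal_mul])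

/-- the level pairing, unfolded. [cite: Balaban1985BackgroundPropagators, (3.24) p.394 (bookkeeping)] -/
theorem levForm_apply (φ ψ : levSupp (𝔸 := 𝔸) m Λ) :
    levForm τ m Λ φ ψ = ∑ j ∈ Finset.range (m + 1), ∑ y ∈ Λ j, (τ (star ((φ : ℕ × Site d → 𝔸) (j, y)) * (ψ : ℕ × Site d → 𝔸) (j, y))).re := rfl

/-- each diagonal term `Re τ(a* a)` is non-negative for a faithful positive trace. [folklore] -/
private theorem re_trace_star_mul_self_nonneg (hτp : ∀ a : 𝔸, a ≠ 0 → 0 < (τ (star a * a)).re) (b : 𝔸) : 0 ≤ (τ (star b * b)).re := by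
  by_cases hb : b = 0
  · rw [hb, mul_zero, map_zero, Complex.zero_re]
  · exact (hτp b hb).le

/-- `⟨φ, φ⟩_τ ≥ 0` on `L²(𝔅, ·)` (faithful `τ`). [cite: Balaban1985BackgroundPropagators, p.390 («|X|² = tr X*X»)] -/
theorem levForm_self_nonneg (hτp : ∀ a : 𝔸, a ≠ 0 → 0 < (τ (star a * a)).re) (φ : levSupp (𝔸 := 𝔸) m Λ) : 0 ≤ levForm τ m Λ φ φ := by
  rw [levForm_apply]
  exact Finset.sum_nonneg fun j _ => Finset.sum_nonneg fun y _ => re_trace_star_mul_self_nonneg τ hτp _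

/-- **`⟨φ, φ⟩_τ = 0 ⟹ φ = 0` on `L²(𝔅, ·)`** (faithful `τ`). [cite: Balaban1985BackgroundPropagators, p.390 («|X|² = tr X*X»)] -/
theorem levForm_self_eq_zero (hτp : ∀ a : 𝔸, a ≠ 0 → 0 < (τ (star a * a)).re) {φ : levSupp (𝔸 := 𝔸) m Λ} (h : levForm τ m Λ φ φ = 0) : φ = 0 := by
  rw [levForm_apply] at h
  have hj : ∀ j ∈ Finset.range (m + 1), ∑ y ∈ Λ j, (τ (star ((φ : ℕ × Site d → 𝔸) (j, y)) * (φ : ℕ × Site d → 𝔸) (j, y))).re = 0 :=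
    (Finset.sum_eq_zero_iff_of_nonneg fun j _ => Finset.sum_nonneg fun y _ => re_trace_star_mul_self_nonneg τ hτp _).1 h
  apply Subtype.ext
  funext p
  by_cases hp : p.1 ∈ Finset.range (m + 1) ∧ p.2 ∈ Λ p.1
  · have hy := (Finset.sum_eq_zero_iff_of_nonneg fun y _ => re_trace_star_mul_self_nonneg τ hτp _).1 (hj p.1 hp.1) p.2 hp.2
    by_contra hne
    exact (hτp _ hne).ne' hy
  · exact φ.2 p hp

/-- **`L²(𝔅, ·)` IS FINITE-DIMENSIONAL** (finitely many constraint points, finite-dimensional fibre). [cite: Balaban1985BackgroundPropagators, (3.18) p.393 («𝔅»)] -/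
theorem finiteDimensional_levSupp [FiniteDimensional ℝ 𝔸] : FiniteDimensional ℝ (levSupp (𝔸 := 𝔸) m Λ) := by
  classical
  let B : Finset (ℕ × Site d) := (Finset.range (m + 1)).biUnion fun j => (Λ j).image (Prod.mk j)
  let res : levSupp (𝔸 := 𝔸) m Λ →ₗ[ℝ] ((↥B) → 𝔸) :=
    { toFun := fun φ p => (φ : ℕ × Site d → 𝔸) p.1
      map_add' := fun φ ψ => rfl
      map_smul' := fun c φ => rfl }
  refine FiniteDimensional.of_injective res fun φ ψ h => ?_
  apply Subtype.ext
  funext p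
  by_cases hp : p.1 ∈ Finset.range (m + 1) ∧ p.2 ∈ Λ p.1
  · have hpB : p ∈ B := by
      rw [Finset.mem_biUnion]
      exact ⟨p.1, hp.1, Finset.mem_image.2 ⟨p.2, hp.2, rfl⟩⟩
    exact congr_fun h ⟨p, hpB⟩
  · rw [φ.2 p hp, ψ.2 p hp]

end Carrier

/-! ## §2  `Q′ : L²(Ω₀, ·) → L²(𝔅, ·)`, its adjoint `Q′*`, and the adjointness identity -/

section Averaging

variable (L : ℕ) (U₀ : Site d → Fin d → 𝔸ˣ) (τ : 𝔸 →ₗ[ℂ] ℂ) (m : ℕ) (Λ : ℕ → Finset (Site d)) (s : Finset (Site d))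

open Classical in
/-- ★ **`Q′ = (𝟙_{Λ_j}Q′_j(U₀))_{j ≤ m} : L²(Ω₀, ·) → L²(𝔅, ·)`** — the multi-level averaging onto the constraint sets ((3.18)–(3.19): «N(Q′) = {λ : Q′λ = 0}» is
its kernel). [cite: Balaban1985BackgroundPropagators, (3.18)–(3.19) p.393, (3.21) p.394] -/
def QprimeVec : suppSub (𝔸 := 𝔸) s →ₗ[ℝ] levSupp (𝔸 := 𝔸) m Λ where
  toFun f := ⟨fun p => if p.1 ∈ Finset.range (m + 1) ∧ p.2 ∈ Λ p.1 then QprimeIter (zdBlocking d L) (bgT L U₀) p.1 (f : Site d → 𝔸) p.2 else 0,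
    fun p hp => if_neg hp⟩
  map_add' f g := by
    apply Subtype.ext
    funext p
    simp only [Submodule.coe_add, Pi.add_apply]
    split_ifs with h
    · have := congr_fun (QprimeIter_add (zdBlocking d L) (bgT L U₀) (f : Site d → 𝔸) (g : Site d → 𝔸) p.1) p.2
      exact this
    · rw [add_zero]
  map_smul' c f := by
    apply Subtype.ext
    funext p
    simp only [Submodule.coe_smul, Pi.smul_apply, RingHom.id_apply]
    split_ifs with h
    · have := congr_fun ((QprimeLin L U₀ p.1).map_smul c (f : Site d → 𝔸)) p.2
      simpa only [QprimeLin_apply, Pi.smul_apply] using this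
    · rw [smul_zero]

/-- `Q′f` at a constraint point. [cite: Balaban1985BackgroundPropagators, (3.19) p.393 (bookkeeping)] -/
theorem QprimeVec_apply_of_mem (f : suppSub (𝔸 := 𝔸) s) {j : ℕ} {y : Site d} (hj : j ∈ Finset.range (m + 1)) (hy : y ∈ Λ j) :
    (QprimeVec L U₀ m Λ s f : ℕ × Site d → 𝔸) (j, y) = QprimeIter (zdBlocking d L) (bgT L U₀) j (f : Site d → 𝔸) y := by
  show (if (j, y).1 ∈ Finset.range (m + 1) ∧ (j, y).2 ∈ Λ (j, y).1 then _ else _) = _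
  rw [if_pos ⟨hj, hy⟩]

variable [FiniteDimensional ℝ 𝔸] (hτp : ∀ a : 𝔸, a ≠ 0 → 0 < (τ (star a * a)).re)

/-- ★ **`Q′* : L²(𝔅, ·) → L²(Ω₀, ·)`** — the `τ`-adjoint of `Q′`: `φ ↦ Ω₀ Σ_{j ≤ m} Q′_j(U₀)ᵀ_{Λ_j} φ_j` with the Riesz transposes of `B9Eq324DeltaPrimeAZd`.
[cite: Balaban1985BackgroundPropagators, (3.25) p.394 («Q′*»), p.391 («the adjoints …»)] -/
def QprimeStar : levSupp (𝔸 := 𝔸) m Λ →ₗ[ℝ] suppSub (𝔸 := 𝔸) s :=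
  (restrictSite s).comp
    { toFun := fun φ => ∑ j ∈ Finset.range (m + 1), transposeOn τ hτp (QprimeLin L U₀ j) (Λ j) (fun y => (φ : ℕ × Site d → 𝔸) (j, y))
      map_add' := fun φ ψ => by
        rw [← Finset.sum_add_distrib]
        refine Finset.sum_congr rfl fun j _ => ?_
        rw [← B9Eq324DeltaPrimeAZd.transposeOn_add]
        rfl
      map_smul' := fun c φ => by
        rw [RingHom.id_apply, Finset.smul_sum]
        refine Finset.sum_congr rfl fun j _ => ?_
        rw [← B9Eq324DeltaPrimeAZd.transposeOn_smul]
        rfl }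

/-- `Q′*φ`, unfolded. [cite: Balaban1985BackgroundPropagators, (3.25) p.394 (bookkeeping)] -/
theorem QprimeStar_coe (φ : levSupp (𝔸 := 𝔸) m Λ) :
    (QprimeStar L U₀ τ m Λ s hτp φ : Site d → 𝔸) =
      (↑s : Set (Site d)).indicator (∑ j ∈ Finset.range (m + 1),
        transposeOn τ hτp (QprimeLin L U₀ j) (Λ j) (fun y => (φ : ℕ × Site d → 𝔸) (j, y))) := rfl

/-- ★★ **ADJOINTNESS: `⟨Q′*φ, f⟩_{τ,Ω₀} = ⟨φ, Q′f⟩_{τ,𝔅}`** for `f ∈ L²(Ω₀, ·)`, `φ ∈ L²(𝔅, ·)` (Hermitian `τ`) — `Q′*` IS the adjoint of `Q′`.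
[cite: Balaban1985BackgroundPropagators, (3.25) p.394, p.391 («The adjoints are taken with respect to natural L² scalar products»)] -/
theorem formE_qprimeStar (hτs : ∀ a : 𝔸, τ (star a) = starRingEnd ℂ (τ a)) (φ : levSupp (𝔸 := 𝔸) m Λ) (f : suppSub (𝔸 := 𝔸) s) :
    formE τ s (QprimeStar L U₀ τ m Λ s hτp φ) f = levForm τ m Λ φ (QprimeVec L U₀ m Λ s f) := by
  rw [formE_apply, levForm_apply]
  -- drop the indicator on `s`, expand the level sum, flip, and apply the adjoint identity level by level
  have h1 : ∀ x ∈ s, (τ (star ((QprimeStar L U₀ τ m Λ s hτp φ : Site d → 𝔸) x) * (f : Site d → 𝔸) x)).re =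
      ∑ j ∈ Finset.range (m + 1), (τ (star ((f : Site d → 𝔸) x) *
        transposeOn τ hτp (QprimeLin L U₀ j) (Λ j) (fun y => (φ : ℕ × Site d → 𝔸) (j, y)) x)).re := by
    intro x hx
    rw [QprimeStar_coe, Set.indicator_of_mem (Finset.mem_coe.2 hx), ← fibreForm_apply, fibreForm_comm τ hτs, fibreForm_apply,
      Finset.sum_apply, Finset.mul_sum, map_sum, Complex.re_sum]
  rw [Finset.sum_congr rfl h1, Finset.sum_comm]
  refine Finset.sum_congr rfl fun j hj => ?_
  rw [sum_pair_transposeOn τ hτp hτs (QprimeLin L U₀ j) (Λ j) _ (S := s) (fun k hk => ?_)]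
  · refine Finset.sum_congr rfl fun y hy => ?_
    rw [QprimeVec_apply_of_mem L U₀ m Λ s f hj hy, QprimeLin_apply, ← fibreForm_apply, fibreForm_comm τ hτs, fibreForm_apply]
  · by_contra hks
    exact hk (f.2 k hks)

end Averaging

/-! ## §3  `Q′G′(U₀)²Q′*` on `L²(𝔅, ·)` and its quadratic form `‖G′Q′*φ‖²` -/

section QGGQ

variable (L : ℕ) (U₀ : Site d → Fin d → 𝔸ˣ) (η : ℝ) (τ : 𝔸 →ₗ[ℂ] ℂ) [FiniteDimensional ℝ 𝔸]
  (hτp : ∀ a : 𝔸, a ≠ 0 → 0 < (τ (star a * a)).re) (m : ℕ) (a : ℕ → ℝ) (Λ : ℕ → Finset (Site d)) (s : Finset (Site d))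
  (hd : 0 < d) (hη : η ≠ 0) (hτt : ∀ a b : 𝔸, τ (a * b) = τ (b * a)) (hτs : ∀ a : 𝔸, τ (star a) = starRingEnd ℂ (τ a))
  (hU : ∀ (x : Site d) (κ : Fin d), U₀ x κ ∈ unitaryUnits 𝔸) (ha : ∀ j, 0 ≤ a j)

/-- ★ **`Q′G′(U₀)²Q′*` ON `L²(𝔅, ·)`** — with `G′(U₀) = (Ω₀Δ′_aΩ₀)⁻¹` the object of `B9Eq324DeltaPrimeAZd` (every unitary `U₀`, `a ≥ 0`, finite `Ω₀`).
[cite: Balaban1985BackgroundPropagators, (3.25) p.394] -/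
def qggq : levSupp (𝔸 := 𝔸) m Λ →ₗ[ℝ] levSupp (𝔸 := 𝔸) m Λ :=
  (QprimeVec L U₀ m Λ s).comp
    ((GpZd L U₀ η τ hτp m a Λ s hd hη hτt hτs hU ha).toLinearMap.comp
      ((GpZd L U₀ η τ hτp m a Λ s hd hη hτt hτs hU ha).toLinearMap.comp (QprimeStar L U₀ τ m Λ s hτp)))

/-- `Q′G′²Q′*φ`, unfolded. [cite: Balaban1985BackgroundPropagators, (3.25) p.394 (bookkeeping)] -/
theorem qggq_apply (φ : levSupp (𝔸 := 𝔸) m Λ) :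
    qggq L U₀ η τ hτp m a Λ s hd hη hτt hτs hU ha φ =
      QprimeVec L U₀ m Λ s (GpZd L U₀ η τ hτp m a Λ s hd hη hτt hτs hU ha
        (GpZd L U₀ η τ hτp m a Λ s hd hη hτt hτs hU ha (QprimeStar L U₀ τ m Λ s hτp φ))) := rfl

/-- ★★ **`⟨φ, Q′G′²Q′*φ⟩_τ = ⟨G′Q′*φ, G′Q′*φ⟩_τ`** — adjointness of `Q′ ∕ Q′*` and symmetry of `G′`.
[cite: Balaban1985BackgroundPropagators, (3.25) p.394, Thm 3.11 p.416 («positive definite. This is obvious»)] -/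
theorem levForm_qggq_self (φ : levSupp (𝔸 := 𝔸) m Λ) :
    levForm τ m Λ φ (qggq L U₀ η τ hτp m a Λ s hd hη hτt hτs hU ha φ) =
      formE τ s (GpZd L U₀ η τ hτp m a Λ s hd hη hτt hτs hU ha (QprimeStar L U₀ τ m Λ s hτp φ))
        (GpZd L U₀ η τ hτp m a Λ s hd hη hτt hτs hU ha (QprimeStar L U₀ τ m Λ s hτp φ)) := by
  rw [qggq_apply, ← formE_qprimeStar L U₀ τ m Λ s hτp hτs, formE_GpZd_symm hd hη hτt hτs hU ha]

omit [FiniteDimensional ℝ 𝔸] in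
include hτp in
/-- each diagonal term `Re τ(a* a)` is non-negative for a faithful positive trace. [folklore] -/
private theorem re_trace_star_mul_self_nonneg' (b : 𝔸) : 0 ≤ (τ (star b * b)).re := by
  by_cases hb : b = 0
  · rw [hb, mul_zero, map_zero, Complex.zero_re]
  · exact (hτp b hb).le

/-- **`⟨φ, Q′G′²Q′*φ⟩_τ ≥ 0`.** [cite: Balaban1985BackgroundPropagators, Thm 3.11 p.416] -/
theorem levForm_qggq_self_nonneg (φ : levSupp (𝔸 := 𝔸) m Λ) : 0 ≤ levForm τ m Λ φ (qggq L U₀ η τ hτp m a Λ s hd hη hτt hτs hU ha φ) := by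
  rw [levForm_qggq_self, formE_apply]
  exact Finset.sum_nonneg fun x _ => re_trace_star_mul_self_nonneg' τ hτp _

/-- **`Q′G′²Q′*` IS SYMMETRIC for the level pairing.** [cite: Balaban1985BackgroundPropagators, (3.25) p.394] -/
theorem levForm_qggq_symm (φ ψ : levSupp (𝔸 := 𝔸) m Λ) :
    levForm τ m Λ φ (qggq L U₀ η τ hτp m a Λ s hd hη hτt hτs hU ha ψ) = levForm τ m Λ ψ (qggq L U₀ η τ hτp m a Λ s hd hη hτt hτs hU ha φ) := by
  rw [qggq_apply, qggq_apply, ← formE_qprimeStar L U₀ τ m Λ s hτp hτs, ← formE_qprimeStar L U₀ τ m Λ s hτp hτs]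
  set G := GpZd L U₀ η τ hτp m a Λ s hd hη hτt hτs hU ha
  set u := QprimeStar L U₀ τ m Λ s hτp φ
  set v := QprimeStar L U₀ τ m Λ s hτp ψ
  rw [← formE_GpZd_symm hd hη hτt hτs hU ha u (G v), (formE_isSymm τ s hτs).eq (G u) (G v), formE_GpZd_symm hd hη hτt hτs hU ha v (G u)]

/-- **THE DISPLAYED HYPOTHESIS — «`Q′` IS ONTO» = `Q′*` INJECTIVE ON `L²(𝔅, ·)`** (print's block geometry: the blocks `B^j(y)`, `y ∈ Λ_j`, are disjoint and lie
in `Ω₀`, so the averages can be prescribed independently; §5 gives a sufficient site-separation clause). [cite: Balaban1985BackgroundPropagators, (3.18)–(3.19) p.393, (3.25) p.394] -/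
def QprimeStarInjective (L : ℕ) (U₀ : Site d → Fin d → 𝔸ˣ) (τ : 𝔸 →ₗ[ℂ] ℂ) (hτp : ∀ a : 𝔸, a ≠ 0 → 0 < (τ (star a * a)).re) (m : ℕ)
    (Λ : ℕ → Finset (Site d)) (s : Finset (Site d)) : Prop :=
  Function.Injective (QprimeStar L U₀ τ m Λ s hτp)

/-- ★★ **`⟨φ, Q′G′²Q′*φ⟩_τ = 0 ⟹ φ = 0`** when `Q′*` is injective: `‖G′Q′*φ‖² = 0 ⟹ G′Q′*φ = 0 ⟹ Q′*φ = 0 ⟹ φ = 0`.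
[cite: Balaban1985BackgroundPropagators, Thm 3.11 p.416 («(Q′G′²Q′*)⁻¹ … positive definite. This is obvious»)] -/
theorem levForm_qggq_self_eq_zero (hinj : QprimeStarInjective L U₀ τ hτp m Λ s) {φ : levSupp (𝔸 := 𝔸) m Λ}
    (h0 : levForm τ m Λ φ (qggq L U₀ η τ hτp m a Λ s hd hη hτt hτs hU ha φ) = 0) : φ = 0 := by
  rw [levForm_qggq_self] at h0
  have hG : GpZd L U₀ η τ hτp m a Λ s hd hη hτt hτs hU ha (QprimeStar L U₀ τ m Λ s hτp φ) = 0 := formE_apply_self_eq_zero τ s hτp h0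
  have hQ : QprimeStar L U₀ τ m Λ s hτp φ = 0 := by
    have := congrArg (deltaPrimeADom L U₀ η τ hτp m a Λ s) hG
    rwa [deltaPrimeADom_GpZd hd hη hτt hτs hU ha, map_zero] at this
  exact hinj (by rw [hQ, map_zero])

end QGGQ

/-! ## §4  Theorem 3.11, third «obvious» operator, at the carrier: `(Q′G′²Q′*)⁻¹` as an object -/

section Inverse

variable (L : ℕ) (U₀ : Site d → Fin d → 𝔸ˣ) (η : ℝ) (τ : 𝔸 →ₗ[ℂ] ℂ) [FiniteDimensional ℝ 𝔸]
  (hτp : ∀ a : 𝔸, a ≠ 0 → 0 < (τ (star a * a)).re) (m : ℕ) (a : ℕ → ℝ) (Λ : ℕ → Finset (Site d)) (s : Finset (Site d))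
  (hd : 0 < d) (hη : η ≠ 0) (hτt : ∀ a b : 𝔸, τ (a * b) = τ (b * a)) (hτs : ∀ a : 𝔸, τ (star a) = starRingEnd ℂ (τ a))
  (hU : ∀ (x : Site d) (κ : Fin d), U₀ x κ ∈ unitaryUnits 𝔸) (ha : ∀ j, 0 ≤ a j) (hinj : QprimeStarInjective L U₀ τ hτp m Λ s)

include hinj in
/-- ★★★ **THEOREM 3.11, THIRD OPERATOR, AT THE `ℤᵈ` CARRIER: `Q′G′(U₀)²Q′*` IS INVERTIBLE ON `L²(𝔅, ·)`** for EVERY unitary `U₀`, `a ≥ 0`, finite `Ω₀`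
(`0 < d`, `η ≠ 0`, tracial Hermitian faithful `τ` on a finite-dimensional `𝔸`), given the injectivity of `Q′*` — positive definite ⟹ injective ⟹ bijective.
[cite: Balaban1985BackgroundPropagators, Thm 3.11 p.416, (3.25) p.394 («if Δ′_a, Q′G′²Q′* are invertible. It will be proved later»)] -/
theorem qggq_bijective : Function.Bijective (qggq L U₀ η τ hτp m a Λ s hd hη hτt hτs hU ha) := by
  haveI := finiteDimensional_levSupp (𝔸 := 𝔸) m Λ
  have hinj' : Function.Injective (qggq L U₀ η τ hτp m a Λ s hd hη hτt hτs hU ha) := by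
    rw [← LinearMap.ker_eq_bot, Submodule.eq_bot_iff]
    intro φ hφ
    rw [LinearMap.mem_ker] at hφ
    refine levForm_qggq_self_eq_zero L U₀ η τ hτp m a Λ s hd hη hτt hτs hU ha hinj ?_
    rw [hφ, map_zero]
  exact ⟨hinj', LinearMap.injective_iff_surjective.1 hinj'⟩

/-- ★ **`(Q′G′²Q′*)⁻¹` AS AN OBJECT** — a linear equivalence of `L²(𝔅, ·)`. [cite: Balaban1985BackgroundPropagators, (3.25) p.394, Thm 3.11 p.416] -/
def cZd : levSupp (𝔸 := 𝔸) m Λ ≃ₗ[ℝ] levSupp (𝔸 := 𝔸) m Λ :=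
  (LinearEquiv.ofBijective _ (qggq_bijective L U₀ η τ hτp m a Λ s hd hη hτt hτs hU ha hinj)).symm

/-- **`(Q′G′²Q′*)⁻¹ (Q′G′²Q′* φ) = φ`.** [cite: Balaban1985BackgroundPropagators, (3.25) p.394] -/
theorem cZd_qggq (φ : levSupp (𝔸 := 𝔸) m Λ) :
    cZd L U₀ η τ hτp m a Λ s hd hη hτt hτs hU ha hinj (qggq L U₀ η τ hτp m a Λ s hd hη hτt hτs hU ha φ) = φ := by
  rw [cZd, ← LinearEquiv.ofBijective_apply (hf := qggq_bijective L U₀ η τ hτp m a Λ s hd hη hτt hτs hU ha hinj), LinearEquiv.symm_apply_apply]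

/-- **`Q′G′²Q′* ((Q′G′²Q′*)⁻¹ φ) = φ`.** [cite: Balaban1985BackgroundPropagators, (3.25) p.394] -/
theorem qggq_cZd (φ : levSupp (𝔸 := 𝔸) m Λ) :
    qggq L U₀ η τ hτp m a Λ s hd hη hτt hτs hU ha (cZd L U₀ η τ hτp m a Λ s hd hη hτt hτs hU ha hinj φ) = φ := by
  rw [cZd, ← LinearEquiv.ofBijective_apply (hf := qggq_bijective L U₀ η τ hτp m a Λ s hd hη hτt hτs hU ha hinj), LinearEquiv.apply_symm_apply]

/-- ★★ **`(Q′G′²Q′*)⁻¹` IS POSITIVE DEFINITE**: `⟨cφ, φ⟩_τ > 0` for `φ ≠ 0`. [cite: Balaban1985BackgroundPropagators, Thm 3.11 p.416] -/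
theorem levForm_cZd_self_pos {φ : levSupp (𝔸 := 𝔸) m Λ} (hφ : φ ≠ 0) :
    0 < levForm τ m Λ (cZd L U₀ η τ hτp m a Λ s hd hη hτt hτs hU ha hinj φ) φ := by
  set ψ := cZd L U₀ η τ hτp m a Λ s hd hη hτt hτs hU ha hinj φ
  have hφψ : φ = qggq L U₀ η τ hτp m a Λ s hd hη hτt hτs hU ha ψ := (qggq_cZd L U₀ η τ hτp m a Λ s hd hη hτt hτs hU ha hinj φ).symm
  have hψ0 : ψ ≠ 0 := by
    intro h0
    apply hφ
    rw [hφψ, h0, map_zero]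
  rw [hφψ]
  rcases (levForm_qggq_self_nonneg L U₀ η τ hτp m a Λ s hd hη hτt hτs hU ha ψ).lt_or_eq with hlt | heq
  · exact hlt
  · exact absurd (levForm_qggq_self_eq_zero L U₀ η τ hτp m a Λ s hd hη hτt hτs hU ha hinj heq.symm) hψ0

/-- **`(Q′G′²Q′*)⁻¹` IS SYMMETRIC for the level pairing.** [cite: Balaban1985BackgroundPropagators, (3.25) p.394] -/
theorem levForm_cZd_symm (φ ψ : levSupp (𝔸 := 𝔸) m Λ) :
    levForm τ m Λ (cZd L U₀ η τ hτp m a Λ s hd hη hτt hτs hU ha hinj φ) ψ =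
      levForm τ m Λ φ (cZd L U₀ η τ hτp m a Λ s hd hη hτt hτs hU ha hinj ψ) := by
  set cφ := cZd L U₀ η τ hτp m a Λ s hd hη hτt hτs hU ha hinj φ
  set cψ := cZd L U₀ η τ hτp m a Λ s hd hη hτt hτs hU ha hinj ψ
  have hφ : φ = qggq L U₀ η τ hτp m a Λ s hd hη hτt hτs hU ha cφ := (qggq_cZd L U₀ η τ hτp m a Λ s hd hη hτt hτs hU ha hinj φ).symm
  have hψ : ψ = qggq L U₀ η τ hτp m a Λ s hd hη hτt hτs hU ha cψ := (qggq_cZd L U₀ η τ hτp m a Λ s hd hη hτt hτs hU ha hinj ψ).symm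
  conv_lhs => rw [hψ]
  conv_rhs => rw [hφ]
  -- `⟨cφ, qggq cψ⟩ = ⟨cψ, qggq cφ⟩ = ⟨qggq cφ, cψ⟩`… both equal by the symmetry of `qggq` and of the pairing
  rw [levForm_qggq_symm L U₀ η τ hτp m a Λ s hd hη hτt hτs hU ha cφ cψ]
  -- `levForm cψ (qggq cφ) = levForm (qggq cφ) cψ` by symmetry of the level pairing
  rw [levForm_apply, levForm_apply]
  refine Finset.sum_congr rfl fun j _ => Finset.sum_congr rfl fun y _ => ?_
  rw [← fibreForm_apply, fibreForm_comm τ hτs, fibreForm_apply]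

end Inverse

/-! ## §5  A sufficient condition for the injectivity of `Q′*`: separating sites -/

section Separating

variable (L : ℕ) (U₀ : Site d → Fin d → 𝔸ˣ) (τ : 𝔸 →ₗ[ℂ] ℂ) [FiniteDimensional ℝ 𝔸]
  (hτp : ∀ a : 𝔸, a ≠ 0 → 0 < (τ (star a * a)).re) (m : ℕ) (Λ : ℕ → Finset (Site d)) (s : Finset (Site d))

/-- **SEPARATING SITES** (print's disjoint-block geometry in operational form): every constraint point `(j, y) ∈ 𝔅` owns a site `x ∈ Ω₀` such that
(a) the fibre map `X ↦ (Q′_j(U₀)(δ_x X))(y)` is SURJECTIVE (a weighted unit transport: `X ↦ L^{−jd}R(Ū₀ʲ(Γ_{y,x}))X`), and (b) NO OTHER constraint point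
`(i, y′) ∈ 𝔅` sees `x`: `(Q′_i(U₀)(δ_x X))(y′) = 0` for all `X`. [cite: Balaban1985BackgroundPropagators, (3.18)–(3.19) p.393 («Λ_j = Ω_j^{(j)} ∖ Ω_{j+1}^{(j)} … Ω_j ∖ Ω_{j+1} = B^j(Λ_j)»)] -/
def SeparatingSites (L : ℕ) (U₀ : Site d → Fin d → 𝔸ˣ) (m : ℕ) (Λ : ℕ → Finset (Site d)) (s : Finset (Site d)) : Prop :=
  ∀ j ∈ Finset.range (m + 1), ∀ y ∈ Λ j, ∃ x ∈ s,
    Function.Surjective (fun X : 𝔸 => QprimeIter (zdBlocking d L) (bgT L U₀) j (single x X) y) ∧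
      ∀ i ∈ Finset.range (m + 1), ∀ y' ∈ Λ i, (i, y') ≠ (j, y) → ∀ X : 𝔸, QprimeIter (zdBlocking d L) (bgT L U₀) i (single x X) y' = 0

/-- ★ **SEPARATING SITES ⟹ `Q′*` INJECTIVE** (Hermitian faithful `τ`): test `Q′*φ = 0` against `δ_x X` for the site `x` of `(j, y)`: by adjointness
`0 = ⟨φ, Q′(δ_xX)⟩_𝔅 = Re τ(φ(j,y)* (Q′_jδ_xX)(y))`, all other constraint points being blind to `x`; surjectivity of the fibre map and non-degeneracy give `φ(j,y) = 0`.
[cite: Balaban1985BackgroundPropagators, (3.18)–(3.19) p.393, (3.25) p.394] -/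
theorem qprimeStarInjective_of_separating (hτs : ∀ a : 𝔸, τ (star a) = starRingEnd ℂ (τ a)) (hsep : SeparatingSites L U₀ m Λ s) :
    QprimeStarInjective L U₀ τ hτp m Λ s := by
  classical
  -- injectivity of a linear map from triviality of its kernel
  intro φ ψ hφψ
  rw [← sub_eq_zero]
  set χ := φ - ψ with hχ
  have h0 : QprimeStar L U₀ τ m Λ s hτp χ = 0 := by rw [hχ, map_sub, hφψ, sub_self]
  apply Subtype.ext
  funext p
  by_cases hp : p.1 ∈ Finset.range (m + 1) ∧ p.2 ∈ Λ p.1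
  · obtain ⟨x, hxs, hsurj, hblind⟩ := hsep p.1 hp.1 p.2 hp.2
    -- the test function `δ_x X ∈ L²(Ω₀, ·)`
    have hmem : ∀ X : 𝔸, single x X ∈ suppSub (𝔸 := 𝔸) s := by
      intro X z hz
      have hzx : z ≠ x := fun h => hz (h ▸ hxs)
      simp [single, hzx]
    have hpair : ∀ X : 𝔸, (τ (star ((χ : ℕ × Site d → 𝔸) p) * QprimeIter (zdBlocking d L) (bgT L U₀) p.1 (single x X) p.2)).re = 0 := by
      intro X
      have h := formE_qprimeStar L U₀ τ m Λ s hτp hτs χ ⟨single x X, hmem X⟩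
      rw [h0, map_zero, LinearMap.zero_apply, levForm_apply] at h
      -- only the constraint point `p` contributes
      rw [eq_comm, Finset.sum_eq_single_of_mem p.1 hp.1 (fun i hi hip => ?_)] at h
      · rw [Finset.sum_eq_single_of_mem p.2 hp.2 (fun y' hy' hyp => ?_)] at h
        · rw [QprimeVec_apply_of_mem L U₀ m Λ s _ hp.1 hp.2] at h
          exact h
        · rw [QprimeVec_apply_of_mem L U₀ m Λ s _ hp.1 hy',
            hblind p.1 hp.1 y' hy' (fun h' => hyp (Prod.ext_iff.1 h').2) X, mul_zero, map_zero, Complex.zero_re]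
      · refine Finset.sum_eq_zero fun y' hy' => ?_
        rw [QprimeVec_apply_of_mem L U₀ m Λ s _ hi hy', hblind i hi y' hy' (fun h' => hip (Prod.ext_iff.1 h').1) X, mul_zero, map_zero,
          Complex.zero_re]
    -- surjectivity of the fibre map + non-degeneracy of `Re τ(a* b)`
    by_contra hne
    obtain ⟨X, hX⟩ := hsurj ((χ : ℕ × Site d → 𝔸) p)
    have := hpair X
    rw [show QprimeIter (zdBlocking d L) (bgT L U₀) p.1 (single x X) p.2 = (χ : ℕ × Site d → 𝔸) p from hX] at this
    exact (hτp _ hne).ne' this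
  · exact χ.2 p hp

omit [FiniteDimensional ℝ 𝔸] in
/-- **A6 ∕ NON-VACUITY — THE ONE-LEVEL GEOMETRY**: at `m = 0` (`Q′_0 = I`, `𝔅 = {0} × Λ_0`) the separating-sites clause holds as soon as `Λ_0 ⊆ Ω₀`
(each constraint point is its own site). [cite: Balaban1985BackgroundPropagators, (3.18)–(3.19) p.393 («Λ_j = Ω_j^{(j)} ∖ Ω_{j+1}^{(j)}», j = 0)] -/
theorem separatingSites_levelZero (hΛ : Λ 0 ⊆ s) : SeparatingSites L U₀ 0 Λ s := by
  classical
  intro j hj y hy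
  have hj0 : j = 0 := by simpa using hj
  subst hj0
  refine ⟨y, hΛ hy, ?_, ?_⟩
  · intro X
    exact ⟨X, by simp [QprimeIter, single]⟩
  · intro i hi y' hy' hne X
    have hi0 : i = 0 := by simpa using hi
    subst hi0
    have hyy : y' ≠ y := fun h => hne (by rw [h])
    simp [QprimeIter, single, hyy]

/-- hence, at `m = 0` with `Λ_0 ⊆ Ω₀`, `Q′*` is injective and `(Q′G′²Q′*)⁻¹` exists for every unitary `U₀` — the hypothesis class of §4 is inhabited.
[cite: Balaban1985BackgroundPropagators, Thm 3.11 p.416, (3.25) p.394] -/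
theorem qprimeStarInjective_levelZero (hτs : ∀ a : 𝔸, τ (star a) = starRingEnd ℂ (τ a)) (hΛ : Λ 0 ⊆ s) :
    QprimeStarInjective L U₀ τ hτp 0 Λ s :=
  qprimeStarInjective_of_separating L U₀ τ hτp 0 Λ s hτs (separatingSites_levelZero L U₀ Λ s hΛ)

end Separating

end Literature.MathematicalPhysics.QuantumFieldTheory.Balaban1983to89.B9Eq325QGGQInvZd

end
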